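import Mathlib
import HarnessLib
import HarnessLib.Audit
import Summits.CriticalPhenomena.Statement
import Literature.Probability.Percolation.CardyFormula
import HarnessLib.Audit.Status.Attr

/-!
Route: CardyTotalPositivity

DORMANT since 2026-08-23T10:29:28Z (reconciler: no traction for 6.1 d (last activity item-evidence-added at 2026-08-17T08:08:36Z); parked, not closed — `ledger route dormant route-CriticalPhenomena-CardyTotalPositivity --off` to reactiv) — unstaffed, not closed; items shared with open routes are served there. `ledger route dormant <id> --off` reactivates.

# Route CardyTotalPositivity — asymptotic total positivity of the half-plane first-hit kernel +
Schoenberg PF-rigidity pin Cardy on Z² up to the half-plane one-arm exponent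

It suffices to show X = AsymptoticKernelTN ∧ CornerAnalyticLimit ∧ HalfPlaneOneArmThird ∧
HalfPlaneTransport (card
total-positivity-first-hit-kernels; rev 1 = the route's single pre-committed pivot after the
lattice-exact crux KernelTN,
stmt-CriticalPhenomena-9322, was refuted by exact computation), where the object is the WIRED
FIRST-HIT KERNEL of bond-ℤ²
at p = 1/2 in the lattice upper half-plane ℤ×ℕ: sources = the boundary arc A_s = {(i,0) : i ≤ −s},
X^(s) = the first
boundary vertex (j,0), j ≥ 1, joined to A_s by an open path of ℤ×ℕ, and P_n(σ,x) = P[A_{σn} ↔ {(j,0)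
: 1 ≤ j ≤ xn}] its
distribution function at scale n. AsymptoticKernelTN: for every order r, all arcs σ₁ < … < σ_r and
all disjoint ordered
windows (a₁,b₁] < … < (a_r,b_r], liminf_n det[P_n(σ_i,b_j) − P_n(σ_i,a_j)]_{i,j} ≥ 0 — total
nonnegativity of every
scaling (sub)limit of the kernel (arcs further left ↑, windows further right ↑), which is all the
engine uses and which
Cardy's own kernel x^{−2/3}σ^{1/3}(x+σ)^{−2/3} satisfies (TP∞ by the Gamma integral for (x+σ)^{−2/3}
and Cauchy–Binet).
CornerAnalyticLimit: P_n(σ,x) → u(x/σ) with u′ = κ > 0 continuous and t^α κ(t) real-analytic at 0⁺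
with no vanishing
Taylor coefficient. Then the engine (support items SelfDualReflection, SchoenbergBetaRigidity,
LimitPositivityPinsValue)
forces u(t) = I_{t/(1+t)}(1−α,1−α), HalfPlaneOneArmThird pins α = 2/3, i.e. half-plane wired 3-mark
Cardy (target
HalfPlaneWiredCardy: limit = F(x/(x+σ)), the conformal rectangle (ℍ; ∞, −σ, 0, x), which realises
every cross-ratio),
and HalfPlaneTransport carries the value to every Jordan conformal rectangle. Lattice-exact
positivity survives only as
support, off the closes path: HalfPlaneKernelTN (all minors of k(s,x) = P[X^(s) = x] in the full
lattice half-plane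
ℤ×ℕ ≥ 0 — undecided by the refuters' computation, sufficient for AsymptoticKernelTN by column
multilinearity) and
SwitchingTP2 (order 2, all p; 0 failures among 64 800 exact box minors).
Lean: `AsymptoticKernelTN ∧ CornerAnalyticLimit ∧ HalfPlaneOneArmThird ∧ HalfPlaneTransport`

## Assembly
The deciding theorem is pure logic: `closes : AsymptoticKernelTN → SelfDualReflection →
CornerAnalyticLimit →
SchoenbergBetaRigidity → HalfPlaneOneArmThird → LimitPositivityPinsValue → HalfPlaneTransport →
CardyFormulaZ2`
(the five hypotheses feed the engine LimitPositivityPinsValue, which yields HalfPlaneWiredCardy, and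
HalfPlaneTransport
maps it to the conjunct; axioms propext / Classical.choice / Quot.sound). The `Assembly` ITEM is the
frame statement X → Statement over the four ranked cruxes alone,
`AsymptoticKernelTN → CornerAnalyticLimit → HalfPlaneOneArmThird → HalfPlaneTransport →
CardyFormulaZ2` (rev 3; the
rev-1/2 text also carried the three support items as hypotheses, hence coincided with the type of
`closes` and was
pure logic — flagged ground.trivial): it is NOT pure logic, it is discharged exactly by the support
items
SelfDualReflection, SchoenbergBetaRigidity and the engine LimitPositivityPinsValue
(Assembly := fun h1 h3 h5 ht ↦ ht (engine h1 h2 h3 h4 h5)). All mathematics sits in the cruxes and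
in the support
items (engine = standard reductions listed under LimitPositivityPinsValue; Schoenberg's theorem is
the only deep
imported analysis fact).

Rationale: WHY THIS LINE. Planar Markov paths (Karlin–McGregor coincidences, KarlinMcgregor1959; loop-erased
walks, Fomin2001) and planar Ising
boundary correlations (switching, Lis2016; positive orthogonal Grassmannian, GalashinPylyavskyy2020)
have totally
positive boundary hitting kernels — the q → 0 and q = 2 members of the random-cluster family — and
Cardy's conjectured
half-plane 3-mark kernel for q = 1, x^{−2/3}σ^{1/3}(x+σ)^{−2/3}, is TP∞ as well ((x+σ)^{−2/3} =
Γ(2/3)^{−1}∫t^{−1/3}e^{−tσ}e^{−tx}dt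
and Cauchy–Binet). Rev 0 bet that bond-ℤ² percolation shares total positivity LATTICE-EXACTLY on
every box; two refuters
killed that by exact enumeration (stmt-CriticalPhenomena-9322: box [−2,4]×[0,2], order-3 minor =
−363195623775744/2^96
≈ −4.6e−15; extent W ≤ 12, H ≤ 8: 2354 of 64 800 minors negative, all of order 3..6 and of size
1e−14…1e−31, none at
H = 8; order 2 NEVER fails) — strips ℤ×[0,H] behave like finite-rank kernels and fail at order ≈
H+1, which says nothing
about the half-plane. Rev 1 (this text; the single pivot pre-committed in the rev-0 kill criteria)
keeps the
identification engine and asks positivity only where the engine uses it: asymptotically, i.e. for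
every scaling
(sub)limit (crux AsymptoticKernelTN), with the lattice-exact half-plane statement HalfPlaneKernelTN
and the order-2
switching inequality SwitchingTP2 kept as off-path support. Imported from classical analysis:
Schoenberg1951 (a Pólya
frequency function is exactly the reciprocal bilateral Laplace transform of a Laguerre–Pólya entire
function), which
turns TN∞ + scale covariance + the lattice duality-reflection u(t)+u(1/t) = 1 into "the Mellin
transform of the limit
law is C e^{γ(z−1)²} Γ(z−α)Γ(2−α−z) × (silent-pole factor)", so that a convergent non-degenerate
corner expansion leaves
ONE number, α = 1 − β₁⁺, and Cardy's ₂F₁ = I_η(1/3,1/3) and its Möbius covariance come OUT of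
positivity instead of being
put in. What it does that no open route does (38 Theses files grep-checked at open: no total
positivity, PF function, MLR
or Mellin-pole rigidity anywhere): the input replacing conformal invariance is a family of
determinant INEQUALITIES on
boundary data plus exact self-duality — no discrete-holomorphic observable, no integrable transfer
matrix, no
Brownian/SLE object on the lattice.

RANKED CRUXES. #0 HalfPlaneWiredCardy (target) — half-plane wired 3-mark Cardy for bond-ℤ² at p =
1/2: for all σ, x > 0, P_{1/2}[the arc {(i,0): i ≤ −σn} is joined inside ℤ×ℕ to {(j,0): 1 ≤ j ≤ xn}]
→ F(x/(x+σ)) (= I_{x/(x+σ)}(1/3,1/3), the crossing probability of (ℍ; ∞, −σ, 0, x), cross-ratio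
x/(x+σ)); equivalently the law of X^(σn)/n converges to the Beta(1/3,1/3) law in η = t/(1+t). (why
it might fail: it contains LimitExists for this event family; Zhang arXiv:2206.04599 (unrefereed)
even claims ¬Cardy on ℤ²; a log-periodic or shear-covariant-only sublimit would break it.)
[CardyJPhysA1992, Smirnov2001, Schramm2007ICM, arXiv:2206.04599]
#2 AsymptoticKernelTN (crux; rev-1 restatement of the refuted KernelTN) — for every r, every 0 < σ₁
< … < σ_r and all windows 0 ≤ a₁ < b₁ ≤ a₂ < b₂ ≤ … ≤ a_r < b_r: for every ε > 0, eventually in n,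
det[P_n(σ_i,b_j) − P_n(σ_i,a_j)]_{i,j ≤ r} ≥ −ε (entry (i,j) = probability that the first boundary
vertex right of 0 hit by the cluster of the arc A_{σ_i n} lies in the window (a_j n, b_j n]); i.e.
every scaling (sub)limit of the wired first-hit kernel is totally nonnegative, arcs further left ↑,
windows further right ↑. [difficulty: open-problem] (why it might fail: true under Cardy, but no
lattice positivity feeds it any more: strips of height H ≤ 7 fail TN at order ≳ H+1,
HalfPlaneKernelTN is undecided, TP2 alone (PF₂) is useless for Schoenberg, and a sign-oscillating
subsequential limit is not excluded by anything known.) [KarlinMcgregor1959, Fomin2001, Karlin1968,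
Schoenberg1951]
#4 CornerAnalyticLimit (crux) — (card K4) the wired half-plane kernel has a scaling limit with a
corner expansion: there are u, κ : ℝ → ℝ, α ∈ (0,1), r > 0 and reals g_k, ALL non-zero, such that
P_n(σ,x) → u(x/σ) for all σ, x > 0 (existence; the dependence on x/σ alone is then automatic), u(0⁺)
= 0, u(+∞) = 1, u′ = κ continuous and positive on (0,∞), and t^α κ(t) = Σ_k g_k t^k on (0,r)
(convergent corner expansion in INTEGER steps with no silent coefficient). For Cardy: α = 2/3,
t^{2/3}κ(t) = c(1+t)^{−2/3}, g_k = c·binom(−2/3,k) ≠ 0. [difficulty: open-problem] (why it might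
fail: here live LimitExists and the boundary OPE: integer-spaced, convergent, non-degenerate corner
expansions are CFT lore, unproved even on 𝕋 beyond leading order; a log-periodic sublimit, a
lognormal-smeared PF∞ fake (γ>0) or one vanishing g_k kills it as stated.) [SmirnovWernerMRL2001,
Nolin2008, CardyJPhysA1992, Schoenberg1951]
#5 HalfPlaneTransport (crux) — half-plane wired 3-mark Cardy implies Cardy's formula for every
conformal rectangle of bond-ℤ² (conformal transport of the VALUE from the realising family (ℍ; ∞,
−σ, 0, x), which covers every cross-ratio x/(x+σ) ∈ (0,1), to all Jordan conformal rectangles in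
G02's discretisation: box exhaustion of the half-plane events uniformly in δ by RSW, realisation of
every η by bottom-marked boxes, and conformal transport of subsequential limits). [difficulty:
open-problem] (why it might fail: it is conformal invariance of ℤ² crossing limits in transport form
(EmbeddingModulusUniqueness: no embedding-blind argument gives it); known proofs go through SLE₆,
which needs Cardy in slit domains, not only for 3 marks in ℍ.) [Smirnov2001, CamiaNewman2007,
Beffara2008, Werner2007]
#6 HalfPlaneOneArmThird (crux) — (shared verbatim with CardyBoundaryCoulombGas.HalfPlaneOneArmThird,
stmt-CriticalPhenomena-5662) the half-plane one-arm exponent of bond-ℤ² at p = 1/2 exists and equals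
1/3: log P[0 ↔ ∂([−n,n]×[0,n]) inside the half-box]/log n → −1/3. In this route it is the single
residual datum: it pins α = 1 − β₁⁺ = 2/3 in the Schoenberg family I_{t/(1+t)}(1−α,1−α).
[difficulty: open-problem] (why it might fail: universally only β₂⁺ = 1 and β₃⁺ = 2 are known on ℤ²;
1/3 is known only through Cardy/SLE₆ on 𝕋, so on ℤ² this may be as hard as the conjunct.)
[SmirnovWernerMRL2001, Nolin2008, LawlerSchrammWernerEJP2002]
Rank 3 is vacant on purpose: the rev-0 rank-3 crux SwitchingTP2 is off the closes path and is
re-badged support (route review, layer objection).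
#9 SchoenbergBetaRigidity (support) — (card K3; pure analysis) if κ is a continuous positive
probability density on (0,∞) whose scale family (σ,x) ↦ κ(x/σ)/σ is TN∞ for σ↑, x↑ (i.e. κ∘exp · exp
is a Pólya frequency function), κ(t) = t^{−2}κ(1/t), and t^α κ(t) = Σ g_k t^k converges on (0,r)
with all g_k ≠ 0 for some α ∈ (0,1), then κ(t) = t^{−α}(1+t)^{2α−2}·Γ(2−2α)/Γ(1−α)². Proof sketch:
Schoenberg1951 Thm 1–2 ⇒ 1/L_f is Laguerre–Pólya, L_f even by the reflection; the expansion
continues L_f meromorphically with simple poles exactly at ±(n+1−α) ⇒ L_f(s) = C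
e^{γs²}Γ(1−α−s)Γ(1−α+s); residues grow like e^{γn²}, so convergence forces γ = 0; Mellin inversion
and ∫κ = 1 (route review: true on paper, Lean-XL). [difficulty: XL] [Schoenberg1951, Karlin1968,
AissenEdreiSchoenbergWhitney1951]
#9 SelfDualReflection (support) — (card P2) asymptotic duality-reflection of the wired half-plane
kernel: P_n(σ,x) + P_n(x,σ) → 1 for all σ, x > 0 (ℤ² self-duality at 1/2 plus the reflection i ↦ −i,
up to the half-mesh shift and the pendant bottom-row dual edges, whose effect is o(1) by RSW and the
boundary multi-arm bounds); in the limit u(t) + u(1/t) = 1, i.e. κ(t) = t^{−2}κ(1/t). [difficulty: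
M] [Grimmett1999, BollobasRiordan2006, SmirnovWernerMRL2001]
#10 LimitPositivityPinsValue (support, rank 10 only so that the gate renders it after the support
decls it names; rev-1 restatement of PositivityPinsValue, whose antecedent KernelTN was false) — the
engine: AsymptoticKernelTN → SelfDualReflection → CornerAnalyticLimit → SchoenbergBetaRigidity →
HalfPlaneOneArmThird → HalfPlaneWiredCardy. Standard reductions: by CornerAnalyticLimit the window
minors converge, so AsymptoticKernelTN gives det[u(b_j/σ_i) − u(a_j/σ_i)] ≥ 0 for all arcs/windows;
dividing by the window lengths and letting them shrink (κ continuous) gives TN∞ of the density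
kernel κ(x/σ)/σ; ∫κ = u(∞) − u(0⁺) = 1; reflection from SelfDualReflection; SchoenbergBetaRigidity
gives u(t) = I_{t/(1+t)}(1−α,1−α); RSW quasi-multiplicativity (uniform in the mesh) links α to the
lattice exponent à la Smirnov–Werner (u(1/m)^k ≍ C^{±k} π₁⁺(1,m^k)), so HalfPlaneOneArmThird forces
α = 2/3; finally I_η(1/3,1/3) = cardyFunction η by hasDerivAt_cardyFunction and cardyFunction_zero.
[difficulty: M] [SmirnovWernerMRL2001, Karlin1968, CardyJPhysA1992]
#9 HalfPlaneKernelTN (support, new in rev 1; NOT on the closes path) — the lattice-exact statement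
that survives the refutation: in the full lattice half-plane ℤ×ℕ (no box), every minor of k(s,x) =
P_{1/2}[(x,0) is the first vertex (j,0), j ≥ 1, joined in ℤ×ℕ to the arc {(i,0): i ≤ −s}] is ≥ 0
(s↑, x↑). Sufficient for AsymptoticKernelTN (sum columns over the lattice points of each window:
multilinearity keeps minors ≥ 0, then pass to n → ∞); the refuters' H-dependence (order-3 witnesses
negative only at H = 2 and increasing to a positive limit in H; order-5 witnesses at W = 11 changing
sign with H and positive from H = 7; nothing negative at H = 8, W ≤ 12) leaves it undecided — a
refutation by certified numerics retires this item only, not the route. [difficulty: L] [Fomin2001,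
KarlinMcgregor1959, Lis2016]
#9 SwitchingTP2 (support; rev-0 crux re-badged, off the closes path) — (card K1 at order 2,
rectangle case; the percolation switching lemma) for every rectangle [0,m]×[0,n] of bond-ℤ², every p
∈ [0,1], sources (0,s), (0,s′) with s < s′ and targets (m,x), (m,x′) with x < x′, the point-source
first-hit kernel K(a,b) = P_p[(m,b) is the lowest right-side vertex joined inside the rectangle to
(0,a)] satisfies K(s,x′)K(s′,x) ≤ K(s,x)K(s′,x′); 0 violations among 597 exact pairs (planner) and
order 2 never fails among the refuters' 64 800 same-side minors; the stand-alone deliverable of the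
card. [difficulty: L] [Fomin2001, Gladkov2024, KarlinMcgregor1959, GalashinPylyavskyy2020]

TWO-LAYER PLAN. Foreseen glued splits (k ≤ 3, depth 1), filed only after a crux closes:
HalfPlaneTransport ⇐ BoxExhaustion (half-plane
3-mark events = limits of bottom-marked box rectangles uniformly in δ, RSW) → SeqConfTransport
(conformal transport of
subsequential limits, the item of route CardyCornerFugacity, to be shared) → BottomMarkedRealises →
HalfPlaneTransport;
CornerAnalyticLimit ⇐ LimitExistsWired (existence + C¹) → CornerExpansion (integer steps,
convergence, g_k ≠ 0) →
CornerAnalyticLimit; AsymptoticKernelTN ⇐ HalfPlaneKernelTN (support, already filed) →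
WindowSummation (column
multilinearity + n → ∞) → AsymptoticKernelTN, or, if HalfPlaneKernelTN dies numerically, ⇐ a
positivity structure of the
left-to-right renewal sequence of boundary clusters (X^(s) is non-decreasing in s; a TP₂ Markov
structure in s would give
all orders by Karlin–McGregor composition) — not filed until someone exhibits the Markov property on
a box.

KILL CRITERIA. The single pre-committed pivot of rev 0 ('violation invisible at order 2 ⇒ restate
KernelTN as asymptotic TN') is SPENT by
this revision; there is no second restatement of the positivity crux. ¬AsymptoticKernelTN — a window
minor of fixed order
whose sign is negative and n-stable at two dyadic scales with disjoint certified error bars (kit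
Monte Carlo / transfer
matrix), or a proof that some subsequential limit kernel has a negative minor — closes the route
(close
refuted:AsymptoticKernelTN); since Cardy's kernel is TP∞ this would also be evidence against
HalfPlaneWiredCardy itself.
A numerical refutation of HalfPlaneKernelTN alone retires that support item (drop with note) and, if
by then no other
lattice source of positivity (renewal/Markov structure, TP factorisation of a half-plane transfer
operator) has been
exhibited on a box, the tenure planner closes the route exhausted rather than carrying an input with
no mechanism. One
planar TP2 violation (¬SwitchingTP2) kills the card's mechanism claim 'percolation is TP at order 2'
and with it the
motivation; close. ¬CornerAnalyticLimit by an explicit non-Beta PF∞ sublimit, or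
¬HalfPlaneOneArmThird, refutes the
conjunct's standard picture, not just this line. HalfPlaneWiredCardy proved elsewhere moots
everything but
HalfPlaneTransport; CardyFormulaZ2 proved elsewhere moots the route (HalfPlaneKernelTN/SwitchingTP2
stay as stand-alone
positivity statements).

NOT DECOMPOSED YET. The exponent link α = 1 − β₁⁺ (quasi-multiplicativity for half-plane one-arm
events of bond-ℤ², uniform in the mesh)
and the passage window minors ⇒ density-kernel TN∞ are kept inside the engine item
LimitPositivityPinsValue; the
pendant-edge / half-mesh bookkeeping of the duality reflection stays inside SelfDualReflection;
Schoenberg's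
representation theorem and Mellin inversion stay inside SchoenbergBetaRigidity until the Literature
fact lands (then
restate with `(h : Fact) →`); the implication HalfPlaneKernelTN → AsymptoticKernelTN is not filed as
an item (it is the
first foreseen split above). The 4-arc upgrade (two finite arcs: TN∞ jointly in two variables, card
K2′), the
point-source kernel (far exponent 1 + β₂⁺ = 2 known) and the left→right rectangle kernel beyond
order 2 are NOT filed.
The refuted rev-0 decl KernelTN (stmt-CriticalPhenomena-9322, 15 evidence files) and the vacuous
rev-0 engine PositivityPinsValue leave the file with this revision (their ledger rows keep the
refutation record); Assembly is restated to the type of `closes`. No third layer.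

CHEAPEST FALSIFIER. (rev 0's — exact enumeration of same-side box minors — was RUN by the refuters
and fired: KernelTN is false on boxes.) Now:
(i) HalfPlaneKernelTN by the refuters' validated exact transfer matrices (tn_sameside.py /
kernel_tn.py on stmt-9322, kit)
on TALL boxes [−L,L′]×[0,H] with H ≥ W = L+L′+1, W = 9..14, tracking the sign of the order-3..6
corner minors
(s, x ≤ 5) as H grows: a corner minor that stays negative as H → ∞ at fixed W, confirmed at the next
W, retires
HalfPlaneKernelTN; (ii) AsymptoticKernelTN by kit Monte Carlo of ONE order-3 window minor with
geometrically spread marks, arcs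
σ = (1/4, 2, 16), windows (0,1/2], (1/2,4], (4,64] (any common rescaling), at two dyadic scales:
under Cardy this minor is
≈ +9.3e−3 (entries ≤ 0.8; computed here from I_η(1/3,1/3)), so 10^6 samples per scale (entry errors
≤ 5e−4, minor error
≲ 1e−3) decide the sign — equally spaced marks are useless (σ = (1,2,3), windows (0,1],(1,2],(2,4]
give +9e−6); a
negative, n-stable sign kills the crux and the route.

NUMBERS. Cardy: F(η) = cardyFunction η, F′(η) = (cardyConst/3)(η(1−η))^{−2/3}, so F = I_η(1/3,1/3);
wired half-plane kernel density in x at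
arc σ: ∝ x^{−2/3}σ^{1/3}(x+σ)^{−2/3}, i.e. κ(t) ∝ t^{−2/3}(1+t)^{−2/3} (α = 2/3 = 1 − β₁⁺), far tail
1 − u(t) ~ c t^{−1/3};
known universal half-plane exponents on ℤ²: β₂⁺ = 1, β₃⁺ = 2 (SmirnovWernerMRL2001 §4,
LawlerSchrammWernerEJP2002 App. A);
β₁⁺ = 1/3 known on 𝕋 only. Schoenberg family left by positivity alone: Mellin transform C
e^{γ(z−1)²} Γ(z−α)Γ(2−α−z)·R_N(z),
parameters (α, γ ≥ 0, N ⊆ ℕ≥1); card's exhibited N = {1} fake: density ∝ [η(1−η)]^{−2/3}(1 +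
(2/3)η(1−η)) (its t¹ corner
coefficient vanishes). Refutation record of rev 0 (stmt-CriticalPhenomena-9322): witness box
[−2,4]×[0,2] (21 vertices,
32 edges), s = (0,1,2), x = (2,3,4), integer counts N = [[87121872, 29207744, 8584768],[83165724,
28133596, 8306936],
[59759811, 20296768, 6005020]], det N = −363195623775744 (two transfer matrices + two 2^32 brute
forces agree); extent
W ≤ 12, H ≤ 8: 2354/64 800 minors negative, orders 3..6, magnitudes 1e−14…1e−31, 0 at H = 8, 0 at
order 2; second
witness [−5,5]×[0,4], order 5, ≈ −7.4e−25. Items after rev 1: 11 (1 target, 4 cruxes, 5 support, 1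
assembly = the type of `closes`).

DEFINITION REQUESTS. Literature facts wanted (cite items): Schoenberg1951 Thm 1–2 (PF∞ ⟺ reciprocal
bilateral Laplace transform in the
Laguerre–Pólya class, with the product form; lit want acq-02721 open, grounder g15-0), and the
Hadamard/Laguerre–Pólya
product calculus it needs; once landed, SchoenbergBetaRigidity is restated with the fact as
hypothesis (home:
Literature/Analysis/TotalPositivity/, next to IsPolyaFrequencySeq). No new notion is needed for the
items as typed
(first-hit events are spelled out over G02's openCrossing/openConnIn). CONE NOTE (route-repair
a995c0de, gen 1 and 2):
needs-fact: NONE — the 16 unproved facts of the import cone all enter through the gate-written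
import
Summits.CriticalPhenomena.Statement (other conjuncts: SAW/SLE, ℤ³ continuity, 3-D Ising, gm_*
percolation facts); no item
of this route mentions any of them, the one explicit import
Literature.Probability.Percolation.CardyFormula carries
CardyFormulaZ2 and cardyFunction themselves, and `closes` is pure logic.

Novelty: Searches (2026-08-15; searchd flaky, OpenAlex/S2 rate-limited): `lit search "total positivity
percolation hitting probabilities planar"` (local 2 irrelevant; Crossref 12: Karlin1964 absorption
probabilities, Köhler-Schindler–Tassion 2023 crossing probabilities — RSW, no TP); `lit search
--source crossref "Polya frequency function Mellin transform Gamma … totally positive kernel scale"`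
(10: Schoenberg1951 itself + Mellin textbooks); `lit search --source zbmath "total positivity Ising
model boundary correlations planar"` (2: GalashinPylyavskyy2020, Lis arXiv:2009.12131
Ashkin–Teller); `lit search --source crossref "planar Ising model total positivity"` (Lis2016); `lit
search --source zbmath "percolation lowest crossing … switching lemma two configurations"` (0); `lit
galaxy search "Polya frequency function" --star all` (20 rows: statistics/spline TP, none
probabilistic-lattice); `lit frontier CriticalPhenomena --since 2022` (30 rows; nearest:
arXiv:2603.28161 boundary four-point CLE connectivities, arXiv:2208.06008 pairing probabilities —
continuum SLE/CLE values, no lattice positivity); grep of all 38 CardyFormulaZ2 Theses files for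
total positivity / Schoenberg / first-hit (0). Plus the card's own zbMATH/Crossref/galaxy list (14
queries, 0 relevant).
Nearest prior art found: Fomin2001 (arXiv:math/0004083: walk matrices / Brownian hitting kernels TN,
coefficientwise by loop erasure — the q → 0 member), KarlinMcgregor1959 (coincidence probabilities),
Lis2016 + GalashinPylyavsk  [refs: 2009.12131, 2603.28161, 2208.06008, math/0004083, 2408.08457, Karlin1964, Schoenberg1951, GalashinPylyavskyy2020, Lis2016, Fomin2001, KarlinMcgregor1959, Gladkov2024]

Barriers (technique_class: total-positivity, switching-lemma, PF-rigidity): - technique_class: total-positivity, switching-lemma, PF-rigidity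
- Literature.Barriers.CriticalPhenomena.SmirnovTriangularOnly: evaded — no colour-switching
identity, no discrete Cauchy–Riemann relation, no triangulation geometry; the lattice input is a
family of minor INEQUALITIES plus ℤ² self-duality, and the 2π/3 structure enters only through the
one imported number β₁⁺ = 1/3 (HalfPlaneOneArmThird), openly.
- Literature.Barriers.CriticalPhenomena.FKParafermionicHalfCauchyRiemann: evaded — nothing is solved
from local linear relations on the medial lattice; analyticity appears only in the continuum, for
the Mellin transform of a TN∞ limit law, via Schoenberg1951.
- Literature.Barriers.CriticalPhenomena.EmbeddingModulusUniqueness: respected, not evaded — the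
engine's output is collinear half-plane boundary data (invariant under real-linear maps, hence
modulus-blind by right) and KernelTN is embedding-SENSITIVE (fails for site-𝕋 and bitten boxes); the
conformal upgrade to Jordan domains is isolated in the crux HalfPlaneTransport, where the barrier
bites and the bet is the DKKMO-type transport of subsequential limits.
- Literature.Barriers.CriticalPhenomena.CoveringLatticeShift: not in class — no site/mixed
reformulation of bond-ℤ², no Beffara interpolation; bond vs site matters here in the right direction
(site-𝕋 fails TN ≥ 3).
- Literature.Barriers.CriticalPhenomena.IsingTrivialityFromDimensionFour: n/a (matched only through
the token switching-lemma) — that barrier blocks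

Novelty grade: new-combination — ROUTE REVIEW (refuter rreview-0815T13-18-0): BROKEN AT RANK-2 CRUX. KernelTN (9322) false as filed — exact order-3 counterexample on box [-2,4]x[0,2] (det=-363195623775744/2^96), found independently by g41-25 (column TM) and by me (row TM + full 2^32 brute force, identical counts). Extent W<=12,H<=8 (refuter refuter-rreview-0815T13-18-0, 2026-08-15T14:34:06Z; prior: arXiv:math/0004083 (Fomin 2001: TN hitting matrices of planar walks), doi:10.2140/pjm.1959.9.1141 (Karlin-McGregor 1959), arXiv:1606.06068 (Lis 2016: planar Ising TP via switching), doi:10.1007/bf02790092 (Schoenberg 1951: PF functions / Laguerre-Polya))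

History (route lifecycle, newest last):
- 2026-08-15T16:57:30Z · rev 2: restated KernelTN (stmt-CriticalPhenomena-9322), Assembly (stmt-CriticalPhenomena-9329) — route-repair a995c0de gen 2 (cone + review), part 2 after the retriage-only rev 1: (1) CONE needs-fact: none — all 16 unproved cone facts enter via the gate-wri (planner-rrepair-CriticalPhenomena-CardyTotalPo-a995c0de-g2-0)
- 2026-08-15T16:57:30Z · rev 2: dropped PositivityPinsValue — route-repair a995c0de gen 2 (cone + review), part 2 after the retriage-only rev 1: (1) CONE needs-fact: none — all 16 unproved cone facts enter via the gate-wri (planner-rrepair-CriticalPhenomena-CardyTotalPo-a995c0de-g2-0)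
- 2026-08-15T21:14:58Z · rev 12: restated Assembly (stmt-CriticalPhenomena-11298) — route-repair a995c0de gen 1 (ground-failed): the only ground flag (blocking) was Assembly = ground.trivial (intros; aesop) — the rev-2 Assembly carried the thre (planner-rground-CriticalPhenomena-CardyTotalPos-a995c0de-0)
- 2026-08-16T02:18:46Z · AUTO-CRUX: 1 conjecture-grade item(s) promoted to crux (SwitchingTP2) — refuter vetting / tiering apply (operator:999:1362873)
- 2026-08-23T10:29:28Z · DORMANT — reconciler: no traction for 6.1 d (last activity item-evidence-added at 2026-08-17T08:08:36Z); parked, not closed — `ledger route dormant route-CriticalPhenomen (operator:999:1063344)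

sub-problem: CardyFormulaZ2 · status: dormant · opened planner-plancard-CriticalPhenomena-CardyFormu-50a02e5f-0 2026-08-15T13:55:46Z · rev 14 · ledger route-CriticalPhenomena-CardyTotalPositivity
GENERATED by the gate from the ledger (D-0016/17). Provers cite these decls: `theorem foo : Summit.CriticalPhenomena.CardyFormulaZ2.Theses.CardyTotalPositivity.<Decl> := …` in Summits/CriticalPhenomena/CardyFormulaZ2/Theorems/<Name>.lean.
-/

namespace Summit.CriticalPhenomena.CardyFormulaZ2.Theses.CardyTotalPositivity

open scoped BigOperators Topology Manifold Classical MeasureTheory ProbabilityTheory Matrix InnerProductSpace ComplexConjugate ContinuousMap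
open Filter Set Function TopologicalSpace MeasureTheory

attribute [summit_statement] _root_.CardyFormulaZ2

/-- item stmt-CriticalPhenomena-9321 · target · rank 0 · open · by planner
why it might fail: Contains existence of the limit for this ℤ² event family (Schramm2007ICM Prob. 2.11, open); Zhang2022 (unrefereed) claims ¬Cardy on ℤ², Zhou2024 (unrefereed) claims Cardy; a log-periodic or shear-covariant-only sublimit breaks it. Convention checked: η = x/(x+σ) = crossRatio(−∞,−σ,0,x), F = cardyFn.
sources: CardyJPhysA1992, Schramm2007ICM, Smirnov2001, Zhang2022CrossingSquareLattice, Zhou2024SLE6BondZ2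
[target] half-plane wired 3-mark Cardy for bond-ℤ² at p = 1/2: for all σ, x > 0, P_{1/2}[the arc
{(i,0): i ≤ −σn} is joined inside ℤ×ℕ to {(j,0): 1 ≤ j ≤ xn}] → F(x/(x+σ)) (= I_{x/(x+σ)}(1/3,1/3),
the crossing probability of (ℍ; ∞, −σ, 0, x), cross-ratio x/(x+σ)); equivalently the law of X^(σn)/n
converges to the Beta(1/3,1/3) law in η = t/(1+t). The value statement the engine delivers; shared
target for any half-plane route. -/
@[route_item "route-CriticalPhenomena-CardyTotalPositivity"]
def HalfPlaneWiredCardy : Prop :=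
  ∀ σ x : ℝ, 0 < σ → 0 < x → Filter.Tendsto (fun n : ℕ ↦ (Literature.Probability.Percolation.bondPercolation (Literature.Probability.LatticeModels.zdGraph 2) Literature.Probability.Percolation.half).real (Literature.Probability.Percolation.openCrossing {v : Literature.Probability.LatticeModels.Site 2 | 0 ≤ v 1} {v | v 1 = 0 ∧ v 0 ≤ -⌊σ * n⌋} {v | v 1 = 0 ∧ 1 ≤ v 0 ∧ v 0 ≤ ⌊x * n⌋})) Filter.atTop (nhds (Literature.Probability.RandomPlanarGeometry.cardyFunction (x / (x + σ))))

/-- item stmt-CriticalPhenomena-11297 · crux · rank 2 · open · by planner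
why it might fail: Implied by Cardy (kernel x^{-2/3}σ^{1/3}(x+σ)^{-2/3} is TP∞), so false only with ¬HalfPlaneWiredCardy (Zhang2022 claims ¬Cardy on ℤ²); now fed by the lattice leaf HalfPlaneKernelTN via the proved split (Lines/split_assembly.lean), itself mechanism-less and possibly microscopically false.
sources: KarlinMcgregor1959, Fomin2001, Karlin1968, Schoenberg1951, Zhang2022CrossingSquareLattice, arXiv:2206.04599
[crux] (rev-1 restatement of the refuted KernelTN, stmt-CriticalPhenomena-9322; the route's single
pre-committed pivot) asymptotic total nonnegativity of the wired half-plane first-hit kernel of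
bond-ℤ² at p = 1/2 at every order: with P_n(σ,x) = P_{1/2}[the arc {(i,0): i ≤ −⌊σn⌋} is joined
inside ℤ×ℕ to {(j,0): 1 ≤ j ≤ ⌊xn⌋}], for every r, all 0 < σ₁ < … < σ_r and all windows 0 ≤ a₁ < b₁
≤ a₂ < b₂ ≤ … ≤ a_r < b_r, and every ε > 0, eventually in n: det[P_n(σ_i,b_j) − P_n(σ_i,a_j)]_{i,j ≤
r} ≥ −ε (entry (i,j) = probability that the first boundary vertex right of 0 hit by the cluster of
the i-th arc lies in the window (a_j n, b_j n]; arcs further left ↑, windows further right ↑).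
Equivalently every scaling (sub)limit of the kernel is totally nonnegative — exactly the input the
engine LimitPositivityPinsValue uses; Cardy's kernel x^{−2/3}σ^{1/3}(x+σ)^{−2/3} is TP∞
((x+σ)^{−2/3} is a Gamma-mixture of e^{−tσ}e^{−tx}; Cauchy–Binet), so the statement is implied by
HalfPlaneWiredCardy. [deps: none] [difficulty: open-problem] -/
@[route_item "route-CriticalPhenomena-CardyTotalPositivity", crux]
def AsymptoticKernelTN : Prop :=
  let P : ℕ → ℝ → ℝ → ℝ := fun n σ x ↦ (Literature.Probability.Percolation.bondPercolation (Literature.Probability.LatticeModels.zdGraph 2) Literature.Probability.Percolation.half).real (Literature.Probability.Percolation.openCrossing {v : Literature.Probability.LatticeModels.Site 2 | 0 ≤ v 1} {v | v 1 = 0 ∧ v 0 ≤ -⌊σ * n⌋} {v | v 1 = 0 ∧ 1 ≤ v 0 ∧ v 0 ≤ ⌊x * n⌋}); ∀ (r : ℕ) (σ a b : Fin r → ℝ), StrictMono σ → (∀ i, 0 < σ i) → (∀ j, 0 ≤ a j ∧ a j < b j) → (∀ j k, j < k → b j ≤ a k) → ∀ ε : ℝ, 0 < ε → ∀ᶠ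 n : ℕ in Filter.atTop, -ε ≤ (Matrix.of fun i j ↦ P n (σ i) (b j) - P n (σ i) (a j)).det

/-- item stmt-CriticalPhenomena-9323 · crux (kind.auto-crux: conjecture-grade) · rank 3 · open · by planner
why it might fail: {X_s=x} is non-monotone, so Harris-FKG/BK-Reimer give only 'crossing <= sum of the two non-crossings'; over EVERY p it is a polynomial inequality per rectangle that may fail near p->0,1 or on long/thin rectangles beyond the checked range (<=2x3 at p in {.3,.5,.7}; E<=17 coefficientwise).
sources: Fomin2001 (arXiv:math/0004083): the q -> 0 analogue, TP via loop erasure, vandenBergKestenJAP1985, ReimerCPC2000, Gladkov2024 (arXiv:2408.08457): nearest percolation-inequality technology, no MLR/TP2, Lis2016 (arXiv:1606.06068): the q = 2 analogue via random-current switching, GalashinPylyavskyy2020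
[crux] (card K1 at order 2, rectangle case; the percolation switching lemma) for every rectangle
[0,m]×[0,n] of bond-ℤ², every p ∈ [0,1], sources (0,s), (0,s′) with s < s′ and targets (m,x), (m,x′)
with x < x′, the point-source first-hit kernel K(a,b) = P_p[(m,b) is the lowest right-side vertex
joined inside the rectangle to (0,a)] satisfies K(s,x′)K(s′,x) ≤ K(s,x)K(s′,x′); conjectured
coefficientwise (a profile-preserving injection on pairs of configurations) for all planar graphs
and edge weights — the q = 1 analogue of Fomin's loop-erasure and of the random-current switching
behind planar-Ising TP. [difficulty: L] -/
@[route_item "route-CriticalPhenomena-CardyTotalPositivity"]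
def SwitchingTP2 : Prop :=
  let K : unitInterval → ℕ → ℕ → ℕ → ℕ → ℝ := fun p m n a b ↦ (Literature.Probability.Percolation.bondPercolation (Literature.Probability.LatticeModels.zdGraph 2) p).real (Literature.Probability.Percolation.openConnIn (↑(Literature.Probability.Percolation.rectangle m n) : Set (Literature.Probability.LatticeModels.Site 2)) ![0, (a : ℤ)] ![(m : ℤ), (b : ℤ)] \ ⋃ c < b, Literature.Probability.Percolation.openConnIn (↑(Literature.Probability.Percolation.rectangle m n) : Set (Literature.Probability.LatticeModels.Site 2)) ![0, (a : ℤ)] ![(m : ℤ), (c : ℤ)]); ∀ (p : unitInterval) (m n s s' x x' : ℕ), s < s' → x < x' → K p m n s x' * K p m n s' x ≤ K p m n s x * K p m n s' x'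

/-- item stmt-CriticalPhenomena-9324 · crux · rank 4 · open · by planner
why it might fail: Contains LimitExists for ℤ² half-plane crossings (open: Schramm2007ICM Prob. 2.11; Zhang2022 claims a non-Cardy limit) plus an INTEGER-step corner expansion with no zero coefficient — true for Cardy's c(1+t)^{-2/3}, but a log-periodic sublimit, non-integer corrections or one g_k = 0 kills it.
sources: Schramm2007ICM, Zhang2022CrossingSquareLattice, CardyJPhysA1992, KlebanZagier2003, SmirnovWernerMRL2001, Nolin2008
[crux] (card K4) the wired half-plane kernel has a scaling limit with a corner expansion: there are
u, κ : ℝ → ℝ, α ∈ (0,1), r > 0 and reals g_k, ALL non-zero, such that P_n(σ,x) → u(x/σ) for all σ, x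
> 0 (existence; the dependence on x/σ alone is then automatic), u(0⁺) = 0, u(+∞) = 1, u′ = κ
continuous and positive on (0,∞), and t^α κ(t) = Σ_k g_k t^k on (0,r) (convergent corner expansion
in INTEGER steps with no silent coefficient). For Cardy: α = 2/3, t^{2/3}κ(t) = c(1+t)^{−2/3}.
[difficulty: open-problem] -/
@[route_item "route-CriticalPhenomena-CardyTotalPositivity", crux]
def CornerAnalyticLimit : Prop :=
  let P : ℕ → ℝ → ℝ → ℝ := fun n σ x ↦ (Literature.Probability.Percolation.bondPercolation (Literature.Probability.LatticeModels.zdGraph 2) Literature.Probability.Percolation.half).real (Literature.Probability.Percolation.openCrossing {v : Literature.Probability.LatticeModels.Site 2 | 0 ≤ v 1} {v | v 1 = 0 ∧ v 0 ≤ -⌊σ * n⌋} {v | v 1 = 0 ∧ 1 ≤ v 0 ∧ v 0 ≤ ⌊x * n⌋}); ∃ (u κ : ℝ → ℝ) (α r : ℝ) (g : ℕ → ℝ), (∀ σ x : ℝ, 0 < σ → 0 < x → Filter.Tendsto (fun n : ℕ ↦ P n σ x) Filter.atTop (nhds (u (x / σ)))) ∧ Filter.Tendsto u (nhdsWithin 0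 (Set.Ioi 0)) (nhds 0) ∧ Filter.Tendsto u Filter.atTop (nhds 1) ∧ ContinuousOn κ (Set.Ioi 0) ∧ (∀ t : ℝ, 0 < t → 0 < κ t ∧ HasDerivAt u (κ t) t) ∧ 0 < α ∧ α < 1 ∧ 0 < r ∧ (∀ k, g k ≠ 0) ∧ ∀ t ∈ Set.Ioo 0 r, HasSum (fun k : ℕ ↦ g k * t ^ k) (t ^ α * κ t)

/-- item stmt-CriticalPhenomena-9325 · crux · rank 5 · open · by planner
why it might fail: It is conformal invariance of ℤ² crossing limits in transport form: ℍ 3-mark values are only dilation/translation data (EmbeddingModulusUniqueness, Beffara2008Universal: no embedding-blind upgrade); the known engine Cardy⇒SLE₆ (CamiaNewman2007 §5 Thm 3) needs Cardy in varying slit domains, not ℍ.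
sources: CamiaNewman2007, Beffara2008Universal, arXiv:0708.3908, Smirnov2001, Werner2007, Literature.Barriers.CriticalPhenomena.EmbeddingModulusUniqueness
[crux] half-plane wired 3-mark Cardy implies Cardy's formula for every conformal rectangle of
bond-ℤ² (conformal transport of the VALUE from the realising family (ℍ; ∞, −σ, 0, x), which covers
every cross-ratio x/(x+σ) ∈ (0,1), to all Jordan conformal rectangles in G02's discretisation: box
exhaustion of the half-plane events uniformly in δ by RSW, realisation of every η by bottom-marked
boxes, and conformal transport of subsequential limits). [difficulty: open-problem] -/
@[route_item "route-CriticalPhenomena-CardyTotalPositivity", crux]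
def HalfPlaneTransport : Prop :=
  HalfPlaneWiredCardy → CardyFormulaZ2

/-- item stmt-CriticalPhenomena-5662 · crux · rank 6 · open · by planner
why it might fail: On ℤ² only the 'universal' exponents β₂⁺=1, β₃⁺=2, α₅=2 are proved (Nolin2008 Rem. 22, Thm 23, §8.1); β₁⁺=1/3 is known on 𝕋 only, via Cardy+SLE₆ (SmirnovWernerMRL2001), Zhou2024's ℤ² eq. (10) rests on a non-rigorous source, and even existence of the log-limit is open.
sources: Nolin2008, SmirnovWernerMRL2001, LawlerSchrammWernerEJP2002, Zhou2024SLE6BondZ2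
[crux] the 2-point rung of the boundary Coulomb gas: the half-plane one-arm exponent of bond-ℤ² at p
= 1/2 exists and equals 1/3 (log P[0 ↔ ∂([−n,n]×[0,n]) inside the half-box]/log n → −1/3); in the
engine it is the mark–mark exponent 2A·1·1 with A = 1/6 from σ² = 3/π — the boundary analogue of
DKLM's companion bulk one-arm theorem, and reportedly the physics input of Zhou's unrefereed
SLE₆-on-ℤ² manuscript (eq. (10)). [difficulty: open-problem] -/
@[route_item "route-CriticalPhenomena-CardyTotalPositivity", crux]
def HalfPlaneOneArmThird : Prop :=
  Filter.Tendsto (fun n : ℕ ↦ Real.log ((Literature.Probability.Percolation.bondPercolation (Literature.Probability.LatticeModels.zdGraph 2) Literature.Probability.Percolation.half).real {ω | ∃ y : Literature.Probability.LatticeModels.Site 2, (y 0 = (n : ℤ) ∨ y 0 = -(n : ℤ) ∨ y 1 = (n : ℤ)) ∧ ω ∈ Literature.Probability.Percolation.openConnIn {v : Literature.Probability.LatticeModels.Site 2 | 0 ≤ v 1 ∧ -(n : ℤ) ≤ v 0 ∧ v 0 ≤ n ∧ v 1 ≤ n} 0 y}) / Real.log n) Filter.atTop (nhds (-(1 / 3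 : ℝ)))

/-- item stmt-CriticalPhenomena-11300 · crux · rank 9 · open · by planner
why it might fail: No q=1 TN mechanism known (LGV needs paths, Lis switching needs currents); the BOX kernel fails TN at order ≈ height+1 with magnitude → 0 (stmt-9322: 2354/64800 strip minors < 0, none at H=8), so a microscopic half-plane violation is not excluded; certification needs explicit RSW tails.
sources: Fomin2001, KarlinMcgregor1959, Lis2016, GalashinPylyavskyy2020, arXiv:math/0004083, arXiv:1606.06068
[support] (new in rev 1; NOT on the closes path) lattice-exact total nonnegativity of the wired
first-hit kernel in the FULL lattice half-plane ℤ×ℕ (no box): for every order r, all s₁ < … < s_r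
and 1 ≤ x₁ < … < x_r, det[k(s_i,x_j)] ≥ 0 where k(s,x) = P_{1/2}[(x,0) is the first vertex (j,0), j
≥ 1, joined inside ℤ×ℕ to the arc {(i,0): i ≤ −s}]. This is what survives the refutation of the box
statement KernelTN (strips ℤ×[0,H], H ≤ 7, fail at order ≈ H+1 with magnitude → 0; the order-3
witnesses are negative only at H = 2 and increase to a positive limit in H; nothing negative at H =
8, W ≤ 12 — refuters g41-25 / rreview-0815T13-18-0 on stmt-CriticalPhenomena-9322); it is sufficient
for AsymptoticKernelTN (sum the columns over the lattice points of each window — multilinearity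
keeps minors ≥ 0 — and let n → ∞) but not necessary: a refutation by certified numerics on tall
boxes retires this item only. [difficulty: L] -/
@[route_item "route-CriticalPhenomena-CardyTotalPositivity"]
def HalfPlaneKernelTN : Prop :=
  let hit : ℕ → ℕ → Set (Literature.Probability.Percolation.BondConfig (Literature.Probability.LatticeModels.Site 2)) := fun s x ↦ Literature.Probability.Percolation.openCrossing {v : Literature.Probability.LatticeModels.Site 2 | 0 ≤ v 1} {v | v 1 = 0 ∧ v 0 ≤ -(s : ℤ)} {![(x : ℤ), 0]} \ Literature.Probability.Percolation.openCrossing {v : Literature.Probability.LatticeModels.Site 2 | 0 ≤ v 1} {v | v 1 = 0 ∧ v 0 ≤ -(s : ℤ)} {v | v 1 = 0 ∧ 1 ≤ v 0 ∧ v 0 < x}; ∀ (r : ℕ) (s x : Fin r → ℕ), StrictMono s → StrictMono x → (∀ j, 1 ≤ x j) → 0 ≤ (Matrix.of fun i j ↦ (Literature.Probability.Percolation.bondPercolation (Literature.Probability.LatticeModels.zdGraph 2) Literature.Probability.Percolation.half).real (hit (s i) (x j))).det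

/-- item stmt-CriticalPhenomena-18625 · support · rank 9 · open · by planner
[support] (strategist cstrat-11297, BC2 redirect of the crux AsymptoticKernelTN; piece X₂ of the
glued split AsymptoticKernelTN ⇐ HalfPlaneKernelTN ∧ FirstHitDecomposition, assembly theorem
asymptoticKernelTN_of_subs landed under Theorems/) first-hit decomposition of the window
probabilities of the wired half-plane kernel, lattice-exact: for every arc parameter s : ℕ and 0 ≤ A
≤ B, P_{1/2}[A_s ↔ {(j,0): 1 ≤ j ≤ B} in ℤ×ℕ] − P_{1/2}[A_s ↔ {(j,0): 1 ≤ j ≤ A} in ℤ×ℕ] =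
Σ_{x=A+1}^{B} k(s,x), where A_s = {(i,0): i ≤ −s} and k(s,x) = P_{1/2}[(x,0) is the first vertex
(j,0), j ≥ 1, joined inside ℤ×ℕ to A_s] is exactly the `hit` kernel of HalfPlaneKernelTN
(stmt-CriticalPhenomena-11300). Proof route (provable now, difficulty M): the crossing event to
[1,A] is contained in the one to [1,B]; their difference is the disjoint union over x ∈ (A,B] of the
first-hit events {arc ↔ (x,0)} minus {arc ↔ [1,x−1]}; all events are measurable
(measurableSet_openCrossing_of_countable, CornerPercolation.lean) and the measure is finite, so
measure_diff + measure_biUnion_finset. Why it is an item and not a helper: it is the load-bearing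
identification between the window kernel of the crux (real marks, floors -/
@[route_item "route-CriticalPhenomena-CardyTotalPositivity"]
def FirstHitDecomposition : Prop :=
  let hit : ℕ → ℕ → Set (Literature.Probability.Percolation.BondConfig (Literature.Probability.LatticeModels.Site 2)) := fun s x ↦ Literature.Probability.Percolation.openCrossing {v : Literature.Probability.LatticeModels.Site 2 | 0 ≤ v 1} {v | v 1 = 0 ∧ v 0 ≤ -(s : ℤ)} {![(x : ℤ), 0]} \ Literature.Probability.Percolation.openCrossing {v : Literature.Probability.LatticeModels.Site 2 | 0 ≤ v 1} {v | v 1 = 0 ∧ v 0 ≤ -(s : ℤ)} {v | v 1 = 0 ∧ 1 ≤ v 0 ∧ v 0 < x}; ∀ (s A B : ℕ), A ≤ B → (Literature.Probability.Percolation.bondPercolation (Literature.Probability.LatticeModels.zdGraph 2) Literature.Probability.Percolation.half).real (Literature.Probability.Percolation.openCrossing {v : Literature.Probability.LatticeModels.Site 2 | 0 ≤ v 1} {v | v 1 = 0 ∧ v 0 ≤ -(s : ℤ)} {v | v 1 = 0 ∧ 1 ≤ v 0 ∧ v 0 ≤ (B : ℤ)}) - (Literature.Probability.Percolation.bondPercolation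 (Literature.Probability.LatticeModels.zdGraph 2) Literature.Probability.Percolation.half).real (Literature.Probability.Percolation.openCrossing {v : Literature.Probability.LatticeModels.Site 2 | 0 ≤ v 1} {v | v 1 = 0 ∧ v 0 ≤ -(s : ℤ)} {v | v 1 = 0 ∧ 1 ≤ v 0 ∧ v 0 ≤ (A : ℤ)}) = ∑ x ∈ Finset.Ioc A B, (Literature.Probability.Percolation.bondPercolation (Literature.Probability.LatticeModels.zdGraph 2) Literature.Probability.Percolation.half).real (hit s x)

/-- item stmt-CriticalPhenomena-9326 · support · rank 9 · open · by planner
sources: Schoenberg1951, Karlin1968, AissenEdreiSchoenbergWhitney1951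
[support] (card K3; pure analysis) if κ is a continuous positive probability density on (0,∞) whose
scale family (σ,x) ↦ κ(x/σ)/σ is TN∞ for σ↑, x↑ (i.e. κ∘exp · exp is a Pólya frequency function),
κ(t) = t^{−2}κ(1/t), and t^α κ(t) = Σ g_k t^k converges on (0,r) with all g_k ≠ 0 for some α ∈
(0,1), then κ(t) = t^{−α}(1+t)^{2α−2}·Γ(2−2α)/Γ(1−α)² (so its distribution function is
I_{t/(1+t)}(1−α,1−α)). Proof sketch (checked by hand in the planner notes): Schoenberg1951 Thm 1–2 ⇒
1/L_f is Laguerre–Pólya, L_f even by the reflection; the expansion continues L_f meromorphically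
with simple poles exactly at ±(n+1−α) ⇒ L_f(s) = C e^{γs²}Γ(1−α−s)Γ(1−α+s); residues grow like
e^{γn²}, so convergence forces γ = 0; Mellin inversion and ∫κ = 1. [difficulty: provable-now] -/
@[route_item "route-CriticalPhenomena-CardyTotalPositivity", crux]
def SchoenbergBetaRigidity : Prop :=
  ∀ (κ : ℝ → ℝ) (α r : ℝ) (g : ℕ → ℝ), 0 < α → α < 1 → 0 < r → ContinuousOn κ (Set.Ioi 0) → (∀ t : ℝ, 0 < t → 0 < κ t) → MeasureTheory.IntegrableOn κ (Set.Ioi 0) → MeasureTheory.integral (MeasureTheory.volume.restrict (Set.Ioi (0 : ℝ))) κ = 1 → (∀ (n : ℕ) (σ x : Fin n → ℝ), StrictMono σ → StrictMono x → (∀ i, 0 < σ i) → (∀ j, 0 < x j) → 0 ≤ (Matrix.of fun i j ↦ κ (x j / σ i) / σ i).det) → (∀ t : ℝ, 0 < t → κ t = κ t⁻¹ / t ^ 2) → (∀ k, g k ≠ 0) → (∀ t ∈ Set.Ioo 0 r, HasSum (fun k : ℕ ↦ g k * t ^ k) (t ^ α * κ t)) → ∀ t : ℝ, 0 < t → κ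 t = t ^ (-α) * (1 + t) ^ (2 * α - 2) * Real.Gamma (2 - 2 * α) / Real.Gamma (1 - α) ^ 2

/-- item stmt-CriticalPhenomena-9327 · support · rank 9 · closed · proved by Summit.CriticalPhenomena.CardyFormulaZ2.Cruxes.HalfPlaneMarkDensityLaw.SketchLine.SelfDual.selfDualReflection (prover) · by planner
sources: Grimmett1999, BollobasRiordan2006, SmirnovWernerMRL2001
[support] (card P2) asymptotic duality-reflection of the wired half-plane kernel: P_n(σ,x) +
P_n(x,σ) → 1 for all σ, x > 0. ℤ² self-duality at 1/2 plus the reflection i ↦ −i maps the dual of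
"arc ↔ first segment after the gap" to the same event with σ and x exchanged, up to the half-mesh
shift and the pendant (bottom-row) dual edges, whose effect is o(1) by RSW and the boundary
multi-arm bounds; in the limit u(t) + u(1/t) = 1, i.e. κ(t) = t^{−2}κ(1/t). [difficulty: M] -/
@[route_item "route-CriticalPhenomena-CardyTotalPositivity", crux]
def SelfDualReflection : Prop :=
  let P : ℕ → ℝ → ℝ → ℝ := fun n σ x ↦ (Literature.Probability.Percolation.bondPercolation (Literature.Probability.LatticeModels.zdGraph 2) Literature.Probability.Percolation.half).real (Literature.Probability.Percolation.openCrossing {v : Literature.Probability.LatticeModels.Site 2 | 0 ≤ v 1} {v | v 1 = 0 ∧ v 0 ≤ -⌊σ * n⌋} {v | v 1 = 0 ∧ 1 ≤ v 0 ∧ v 0 ≤ ⌊x * n⌋}); ∀ σ x : ℝ, 0 < σ → 0 < x → Filter.Tendsto (fun n : ℕ ↦ P n σ x + P n x σ) Filter.atTop (nhds 1)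

/-- item stmt-CriticalPhenomena-11299 · support · rank 10 · open · by planner
sources: SmirnovWernerMRL2001, Karlin1968, CardyJPhysA1992
[support] (glue: the engine of the card; rev-1 restatement of PositivityPinsValue, whose antecedent
KernelTN was false) AsymptoticKernelTN → SelfDualReflection → CornerAnalyticLimit →
SchoenbergBetaRigidity → HalfPlaneOneArmThird → HalfPlaneWiredCardy. Standard reductions: by
CornerAnalyticLimit the window minors converge, so AsymptoticKernelTN gives det[u(b_j/σ_i) −
u(a_j/σ_i)] ≥ 0 for all arcs and windows; divide by the window lengths and let them shrink (κ = u′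
continuous) to get TN∞ of the density kernel κ(x/σ)/σ; ∫κ = u(∞) − u(0⁺) = 1; reflection κ(t) =
t^{−2}κ(1/t) from SelfDualReflection; SchoenbergBetaRigidity gives u(t) = I_{t/(1+t)}(1−α,1−α); RSW
quasi-multiplicativity (uniform in the mesh) links α to the lattice exponent à la Smirnov–Werner
(u(1/m)^k ≍ C^{±k} π₁⁺(1,m^k)), so HalfPlaneOneArmThird forces α = 2/3; finally I_η(1/3,1/3) =
cardyFunction η by hasDerivAt_cardyFunction and cardyFunction_zero. [deps: AsymptoticKernelTN,
SelfDualReflection, CornerAnalyticLimit, SchoenbergBetaRigidity, HalfPlaneOneArmThird,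
HalfPlaneWiredCardy] [difficulty: M] -/
@[route_item "route-CriticalPhenomena-CardyTotalPositivity", crux]
def LimitPositivityPinsValue : Prop :=
  AsymptoticKernelTN → SelfDualReflection → CornerAnalyticLimit → SchoenbergBetaRigidity → HalfPlaneOneArmThird → HalfPlaneWiredCardy

-- earlier Assembly (stmt-CriticalPhenomena-11298, replaced 2026-08-15T21:14:58Z -> stmt-CriticalPhenomena-13777): retired by None — AsymptoticKernelTN → SelfDualReflection → CornerAnalyticLimit → SchoenbergBetaRigidity → HalfPlaneOneArmThird → LimitPositivityPinsValue → HalfPlaneTransport → CardyFormulaZ2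
-- earlier Assembly (stmt-CriticalPhenomena-9329, replaced 2026-08-15T16:57:30Z -> stmt-CriticalPhenomena-11298): retired by None — KernelTN → SelfDualReflection → CornerAnalyticLimit → SchoenbergBetaRigidity → HalfPlaneOneArmThird → PositivityPinsValue → HalfPlaneTransport → CardyFormulaZ2
/-- item stmt-CriticalPhenomena-13777 · assembly · rank 1 · open · by planner
sources: Schoenberg1951, CardyJPhysA1992, Smirnov2001
[assembly] frame statement X → Statement over the four ranked cruxes alone: AsymptoticKernelTN →
CornerAnalyticLimit → HalfPlaneOneArmThird → HalfPlaneTransport → CardyFormulaZ2 (the cruxes suffice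
for bond-ℤ² Cardy). rev-3 restatement for ground: the rev-1/2 text also listed the supports
SelfDualReflection, SchoenbergBetaRigidity, LimitPositivityPinsValue among its hypotheses, so it
coincided with the type of `closes` and was pure logic (ground.trivial: intros; aesop). This version
is NOT pure logic — it is discharged exactly by those three support items (Assembly := fun h1 h3 h5
ht ↦ ht (engine h1 h2 h3 h4 h5), engine = LimitPositivityPinsValue; checked in the planner's
Sketch.lean, where the whole positive / negative / vacuity ground battery fails on it); the deciding
theorem `closes` (all seven on-path items → CardyFormulaZ2) is unchanged. [deps: SelfDualReflection,
SchoenbergBetaRigidity, LimitPositivityPinsValue] [difficulty: M given the supports; open-problem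
alone] -/
@[route_item "route-CriticalPhenomena-CardyTotalPositivity"]
def Assembly : Prop :=
  AsymptoticKernelTN → CornerAnalyticLimit → HalfPlaneOneArmThird → HalfPlaneTransport → CardyFormulaZ2

-- records of items no longer active in this route (dropped / restated):
-- earlier KernelTN (stmt-CriticalPhenomena-9322, replaced 2026-08-15T16:57:30Z -> stmt-CriticalPhenomena-11297): retired by None — let hit : Set (Literature.Probability.LatticeModels.Site 2) → ℕ → ℕ → Set (Literature.Probability.Percolation.BondConfig (Literature.Probability.LatticeModels.Site 2)) := fun D s x ↦ Literature.Probability.Percolation.openCrossing D {v | v 1 = 0 ∧ v 0 ≤ -(s : ℤ)} {![(x :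

/-! D-0027 §2.1 — DECIDING THEOREM (planner-authored via `route open/edit --closes-file`; by planner-rbadge-CriticalPhenomena-CardyTotalPos-a995c0de-0 2026-08-15T20:44:55Z):
its hypotheses are this route's items and its conclusion the sub-problem Statement (glue_lint), and it elaborates with this file. -/

@[closes "route-CriticalPhenomena-CardyTotalPositivity"] theorem closes (h1 : AsymptoticKernelTN) (h2 : SelfDualReflection) (h3 : CornerAnalyticLimit) (h4 : SchoenbergBetaRigidity) (h5 : HalfPlaneOneArmThird) (hengine : LimitPositivityPinsValue) (htransport : HalfPlaneTransport) : CardyFormulaZ2 :=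
  htransport (hengine h1 h2 h3 h4 h5)

end Summit.CriticalPhenomena.CardyFormulaZ2.Theses.CardyTotalPositivity
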